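import Literature.NumberTheory.LFunctions.MoebiusWalshTypeIITools
import Literature.NumberTheory.LFunctions.MoebiusWalshGeomSums
import HarnessLib

/-!
# Type-II core count for the Möbius–Walsh box sums, unshifted window `K = 0` (Bourgain 2013, §2 (2.11)–(2.22))

Topic `Literature/NumberTheory/LFunctions`; proofs-only (theorems, no definition, no named fact).
This is the combinatorial heart of the TYPE-II analysis of J. Bourgain, *Möbius–Walsh correlation
bounds and an estimate of Mauduit and Rivat*, J. Anal. Math. **119** (2013) 147–163
(= arXiv:1109.2784) [Bourgain2013MoebiusWalsh], §2, in the case `K = 0` ((2.13)–(2.22)), isolated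
as an ABSTRACT kernel-sum inequality so that it does not depend on how the preceding steps (van der
Corput differencing (2.2), digit truncation, Fourier expansion (2.5), (2.11)) are booked upstream.

After those steps one faces, for a digit set `S'` on `q = μ + ρ'` digits with Fourier data
`c(k) = |ŵ_{S'}(k/2^q)|` (`Q = 2^q`), shifts `1 ≤ h < H` (`H = L`), the short variable `m ∼ M`
summed into the geometric-series majorant `min(M, 1/(2‖θ‖))` (`Sieve.Vinogradov.geomBound`) and
the long variable `n ∈ [N₁, N₂)`, the quantity
`E = ∑_{1 ≤ h < H} ∑_{k, k' < Q} c(k) c(k') ∑_{n} min(M, 1/(2‖(k(n+h) + k'n)/Q‖))`.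
The theorem `typeII_core_zero` bounds `E` using only three properties of `c ≥ 0`: a sup bound
`c ≤ η` (Lemma 2: `η = 2·2^{-c|S'|}`), and progression bounds `∑_{k ≡ a (2^r)} c(k) ≤ P(r)`
(Lemma 4: `P(r) = 2·2^{κ(q-r)}`, `κ < 1/2`; `P(0)` is the `ℓ¹` bound of Lemma 3). The proof is
Bourgain's: the phase is `((k+k')n + kh)/Q`;
* the DIAGONAL `k + k' ≡ 0 (mod Q)` ((2.13)–(2.14)) is constant in `n` and is paid with the sup
  bound: `≤ N η² ∑_k min(M, 1/(2‖kh/Q‖)) ≤ N η² (2^{v₂(h)+1}M + Q(1 + log Q))`;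
* off the diagonal, with `2^r ∥ k + k' (mod Q)` ((2.16)), the `n`-sum runs over
  `N/2^{q-r} + 1` periods of length `2^{q-r}` (an odd multiplier permutes `ℤ/2^{q-r}`), and one
  period is at most `2·2^{q-r} min(M/2^{q-r}, 1/(2‖kh/2^r‖)) + 2^{q-r}(1 + log Q)` by the REFINED
  kernel sum `MoebiusWalshTypeII.sum_range_geomBound_add_div_le`: the resonant term is only paid
  when `‖kh/2^r‖` is small ((2.17): "implying also `‖k'ℓ/2^r‖ < L^{1+2ε}2^{-r}`"), i.e. on few
  residue classes of `k` modulo `2^{r - v₂(h)}`;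
* on each such class the pair weight `∑ c(k) c(k')` is at most BOTH `η² · #pairs` ((2.21)–(2.22),
  the sup bound) and `P(r - v₂(h)) P(r)` ((2.18)–(2.19), Lemma 4 twice), whence the `min` in the
  statement; the flat term `2^{q-r}(1 + log Q)` is (2.15).
The user (the type-II estimate) chooses where to switch between the two branches of the `min`
((2.20) versus (2.21): at `2^r ≈ ML/L^C`) and sums the resulting geometric series; nothing here
depends on the values of `η`, `P`, and logarithmic losses replace the paper's smooth cutoff `M₁`.

## References

* J. Bourgain, J. Anal. Math. 119 (2013) 147–163, §2, (2.11)–(2.22). [Bourgain2013MoebiusWalsh]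
-/

noncomputable section

open Finset Real

namespace Literature.NumberTheory.LFunctions.MoebiusWalshTypeII

open Literature.NumberTheory.LFunctions.MoebiusWalsh (geomBound_add_nat
  sum_range_geomBound_mul_div_le exists_eq_two_pow_factorization_mul_odd)
open Literature.NumberTheory.Sieve.Vinogradov (distInt geomBound distInt_nonneg distInt_add_int
  geomBound_le geomBound_nonneg geomBound_zero)

/-! ### The phase on and off the diagonal -/

/-- On the diagonal `Q ∣ k + k'` the phase `(k(n+h) + k'n)/Q` is `kh/Q` up to an integer.
[cite: Bourgain2013MoebiusWalsh, §2 (2.13)] -/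
theorem geomBound_pair_of_dvd {q k k' : ℕ} (hd : 2 ^ q ∣ k + k') (V : ℝ) (n h : ℕ) :
    geomBound V (((k : ℝ) * (n + h) + k' * n) / 2 ^ q) = geomBound V ((k : ℝ) * h / 2 ^ q) := by
  obtain ⟨e, he⟩ := hd
  have : ((k : ℝ) * (n + h) + k' * n) / 2 ^ q = (k : ℝ) * h / 2 ^ q + ((n * e : ℕ) : ℝ) := by
    have h2 : (2 : ℝ) ^ q ≠ 0 := by positivity
    have hk : (k : ℝ) + k' = 2 ^ q * e := by exact_mod_cast he
    field_simp
    push_cast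
    linear_combination (n : ℝ) * hk
  rw [this, geomBound_add_nat]

/-- Off the diagonal: with `d = (k + k') mod Q = 2^r d₁`, `d₁` odd, the phase is
`(d₁ n + kh/2^r)/2^{q-r}` up to an integer. [cite: Bourgain2013MoebiusWalsh, §2 (2.16)] -/
theorem geomBound_pair_eq_of_mod {q k k' r d₁ : ℕ} (hr : r ≤ q)
    (hd : (k + k') % 2 ^ q = 2 ^ r * d₁) (V : ℝ) (n h : ℕ) :
    geomBound V (((k : ℝ) * (n + h) + k' * n) / 2 ^ q) =
      geomBound V (((d₁ : ℝ) * n + (k : ℝ) * h / 2 ^ r) / 2 ^ (q - r)) := by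
  have hsplit := Nat.div_add_mod (k + k') (2 ^ q)
  set e := (k + k') / 2 ^ q with he
  have hqr : (2 : ℝ) ^ q = 2 ^ r * 2 ^ (q - r) := by rw [← pow_add, Nat.add_sub_cancel' hr]
  have : ((k : ℝ) * (n + h) + k' * n) / 2 ^ q =
      ((d₁ : ℝ) * n + (k : ℝ) * h / 2 ^ r) / 2 ^ (q - r) + ((n * e : ℕ) : ℝ) := by
    have h2 : (2 : ℝ) ^ r ≠ 0 := by positivity
    have h3 : (2 : ℝ) ^ (q - r) ≠ 0 := by positivity
    have hk : (k : ℝ) + k' = 2 ^ q * e + 2 ^ r * d₁ := by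
      rw [hd] at hsplit; exact_mod_cast hsplit.symm
    rw [hqr] at hk ⊢
    field_simp
    push_cast
    linear_combination (n : ℝ) * hk
  rw [this, geomBound_add_nat]

/-- **The `n`-sum off the diagonal** ((2.15)–(2.17)): if `(k + k') mod 2^q = 2^r d₁` with `d₁`
odd and `r ≤ q`, then for `N₁ ≤ N₂` and `V ≥ 0`,
`∑_{N₁ ≤ n < N₂} min(V, 1/(2‖(k(n+h)+k'n)/2^q‖)) ≤ ((N₂-N₁)/2^{q-r} + 1)(2·2^{q-r} min(V/2^{q-r}, 1/(2‖kh/2^r‖)) + 2^{q-r}(1 + log 2^{q-r}))`.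
[cite: Bourgain2013MoebiusWalsh, §2 (2.15)–(2.17)] -/
theorem sum_Ico_geomBound_pair_le {q k k' r d₁ : ℕ} (hr : r ≤ q) (hd₁ : Odd d₁)
    (hd : (k + k') % 2 ^ q = 2 ^ r * d₁) {V : ℝ} (hV : 0 ≤ V) {N₁ N₂ : ℕ} (hN : N₁ ≤ N₂) (h : ℕ) :
    ∑ n ∈ Ico N₁ N₂, geomBound V (((k : ℝ) * (n + h) + k' * n) / 2 ^ q) ≤
      (((N₂ : ℝ) - N₁) / 2 ^ (q - r) + 1) *
        (2 * 2 ^ (q - r) * geomBound (V / 2 ^ (q - r)) ((k : ℝ) * h / 2 ^ r) +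
          2 ^ (q - r) * (1 + Real.log (2 ^ (q - r)))) := by
  set P : ℕ := 2 ^ (q - r) with hP
  have hP0 : 0 < P := Nat.two_pow_pos _
  have hPR : ((P : ℕ) : ℝ) = (2 : ℝ) ^ (q - r) := by rw [hP]; push_cast; ring
  set γ : ℝ := (k : ℝ) * h / 2 ^ r with hγ
  set f : ℕ → ℝ := fun n => geomBound V (((d₁ : ℝ) * n + γ) / 2 ^ (q - r)) with hf
  have hcop : Nat.Coprime d₁ P := by
    rw [hP]; exact Nat.Coprime.pow_right _ (Nat.coprime_two_right.2 hd₁)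
  have hterm : ∀ n : ℕ, geomBound V (((k : ℝ) * (n + h) + k' * n) / 2 ^ q) = f n := fun n =>
    geomBound_pair_eq_of_mod hr hd V n h
  rw [Finset.sum_congr rfl fun n _ => hterm n]
  have hblock : ∀ n₀ : ℕ, ∑ j ∈ range P, f (n₀ + j) ≤
      2 * P * geomBound (V / P) γ + P * (1 + Real.log P) := by
    intro n₀
    set γ₀ : ℝ := γ + ((d₁ * n₀ : ℕ) : ℝ) with hγ₀
    -- rewrite each term through `(d₁ j) mod P`
    have e1 : ∀ j : ℕ, f (n₀ + j) = (fun i : ℕ => geomBound V (((i : ℝ) + γ₀) / P)) (d₁ * j % P) := by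
      intro j
      simp only [hf]
      have hdm := Nat.div_add_mod (d₁ * j) P
      have : ((d₁ : ℝ) * ((n₀ + j : ℕ) : ℝ) + γ) / 2 ^ (q - r) =
          ((((d₁ * j % P : ℕ) : ℝ)) + γ₀) / P + ((d₁ * j / P : ℕ) : ℝ) := by
        rw [hγ₀, ← hPR]
        have hPr : (P : ℝ) ≠ 0 := by exact_mod_cast hP0.ne'
        have hj : ((d₁ * j : ℕ) : ℝ) = P * ((d₁ * j / P : ℕ) : ℝ) + ((d₁ * j % P : ℕ) : ℝ) := by
          exact_mod_cast hdm.symm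
        field_simp
        push_cast at hj ⊢
        linear_combination hj
      rw [this, geomBound_add_nat]
    rw [Finset.sum_congr rfl fun j _ => e1 j,
      sum_range_comp_mul_mod_eq hP0 hcop (fun i : ℕ => geomBound V (((i : ℝ) + γ₀) / P))]
    have hmain := sum_range_geomBound_add_div_le hV hP0 γ₀
    have e2 : geomBound (V / P) γ₀ = geomBound (V / P) γ := by rw [hγ₀, geomBound_add_nat]
    rwa [e2] at hmain
  have hf0 : ∀ n, 0 ≤ f n := fun n => geomBound_nonneg hV _
  have h := sum_Ico_le_of_forall_sum_range_le hf0 hP0 hblock hN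
  rw [hPR] at h
  exact h

/-! ### Counting residue classes and pair weights -/

/-- A residue class modulo `2^e` (`e ≤ q`) has exactly `2^{q-e}` — in particular at most `2^{q-e}`
— representatives below `2^q`. [folklore] -/
theorem card_filter_range_mod_eq_le {q e : ℕ} (he : e ≤ q) (b : ℕ) :
    ((range (2 ^ q)).filter fun k => k % 2 ^ e = b).card ≤ 2 ^ (q - e) := by
  have hinj : Set.InjOn (fun k => k / 2 ^ e) ((range (2 ^ q)).filter fun k => k % 2 ^ e = b : Set ℕ) := by
    intro k hk k' hk' hkk
    simp only [Finset.coe_filter, Set.mem_setOf_eq] at hk hk'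
    have h1 := Nat.div_add_mod k (2 ^ e)
    have h2 := Nat.div_add_mod k' (2 ^ e)
    simp only at hkk
    rw [← h1, ← h2, hkk, hk.2, hk'.2]
  have hmaps : ∀ k ∈ (range (2 ^ q)).filter (fun k => k % 2 ^ e = b), k / 2 ^ e ∈ range (2 ^ (q - e)) := by
    intro k hk
    rw [Finset.mem_filter, Finset.mem_range] at hk
    rw [Finset.mem_range, Nat.div_lt_iff_lt_mul (Nat.two_pow_pos e), ← pow_add, Nat.sub_add_cancel he]
    exact hk.1
  calc ((range (2 ^ q)).filter fun k => k % 2 ^ e = b).card ≤ (range (2 ^ (q - e))).card :=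
        Finset.card_le_card_of_injOn _ hmaps hinj
    _ = 2 ^ (q - e) := Finset.card_range _

/-- The partner classes: `k' ≡ -k (mod 2^r)` iff `k' mod 2^r = (2^q - k) mod 2^r`
(`k ≤ 2^q`, `r ≤ q`). [folklore] -/
theorem dvd_add_iff_mod_eq {q r k k' : ℕ} (hr : r ≤ q) (hk : k ≤ 2 ^ q) :
    2 ^ r ∣ k + k' ↔ k' % 2 ^ r = (2 ^ q - k) % 2 ^ r := by
  have hqr : 2 ^ r ∣ 2 ^ q := pow_dvd_pow 2 hr
  change 2 ^ r ∣ k + k' ↔ k' ≡ 2 ^ q - k [MOD 2 ^ r]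
  constructor
  · intro h
    -- `k' + k ≡ 0 ≡ 2^q`, subtract `k`
    have h1 : k' + k ≡ 2 ^ q - k + k [MOD 2 ^ r] := by
      rw [Nat.sub_add_cancel hk, add_comm]
      exact (Nat.modEq_zero_iff_dvd.2 h).trans (Nat.modEq_zero_iff_dvd.2 hqr).symm
    exact Nat.ModEq.add_right_cancel' k h1
  · intro h
    have h1 : k' + k ≡ 2 ^ q - k + k [MOD 2 ^ r] := Nat.ModEq.add_right k h
    rw [Nat.sub_add_cancel hk] at h1
    rw [add_comm]
    exact Nat.modEq_zero_iff_dvd.1 (h1.trans (Nat.modEq_zero_iff_dvd.2 hqr))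

/-- **Pair weight, sup branch** ((2.21)–(2.22)): on a residue class `k ≡ a (mod 2^e)`,
`∑_{k ≡ a} c(k) ∑_{k' ≡ -k (2^r)} c(k') ≤ η² 2^{q-e} 2^{q-r}` when `0 ≤ c ≤ η`. [cite: Bourgain2013MoebiusWalsh, §2 (2.21)] -/
theorem pairWeight_le_sup {q e r : ℕ} (he : e ≤ q) (hr : r ≤ q) (c : ℕ → ℝ) (hc0 : ∀ k, 0 ≤ c k)
    {η : ℝ} (hη : ∀ k, c k ≤ η) (a : ℕ) :
    ∑ k ∈ (range (2 ^ q)).filter (fun k => k % 2 ^ e = a % 2 ^ e),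
        c k * ∑ k' ∈ (range (2 ^ q)).filter (fun k' => 2 ^ r ∣ k + k'), c k' ≤
      η ^ 2 * 2 ^ (q - e) * 2 ^ (q - r) := by
  have hη0 : 0 ≤ η := le_trans (hc0 0) (hη 0)
  have hinner : ∀ k ∈ (range (2 ^ q)).filter (fun k => k % 2 ^ e = a % 2 ^ e),
      c k * ∑ k' ∈ (range (2 ^ q)).filter (fun k' => 2 ^ r ∣ k + k'), c k' ≤ η * (η * 2 ^ (q - r)) := by
    intro k hk
    have hkq : k ≤ 2 ^ q := (Finset.mem_range.1 (Finset.mem_filter.1 hk).1).le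
    refine mul_le_mul (hη k) ?_ (Finset.sum_nonneg fun k' _ => hc0 k') hη0
    have hset : (range (2 ^ q)).filter (fun k' => 2 ^ r ∣ k + k') =
        (range (2 ^ q)).filter (fun k' => k' % 2 ^ r = (2 ^ q - k) % 2 ^ r) :=
      Finset.filter_congr fun k' _ => dvd_add_iff_mod_eq hr hkq
    rw [hset]
    calc ∑ k' ∈ (range (2 ^ q)).filter (fun k' => k' % 2 ^ r = (2 ^ q - k) % 2 ^ r), c k'
        ≤ ∑ _k' ∈ (range (2 ^ q)).filter (fun k' => k' % 2 ^ r = (2 ^ q - k) % 2 ^ r), η :=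
          Finset.sum_le_sum fun k' _ => hη k'
      _ ≤ η * 2 ^ (q - r) := by
          rw [Finset.sum_const, nsmul_eq_mul, mul_comm]
          refine mul_le_mul_of_nonneg_left ?_ hη0
          exact_mod_cast card_filter_range_mod_eq_le hr _
  calc ∑ k ∈ (range (2 ^ q)).filter (fun k => k % 2 ^ e = a % 2 ^ e),
        c k * ∑ k' ∈ (range (2 ^ q)).filter (fun k' => 2 ^ r ∣ k + k'), c k'
      ≤ ∑ _k ∈ (range (2 ^ q)).filter (fun k => k % 2 ^ e = a % 2 ^ e), η * (η * 2 ^ (q - r)) :=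
        Finset.sum_le_sum hinner
    _ ≤ 2 ^ (q - e) * (η * (η * 2 ^ (q - r))) := by
        rw [Finset.sum_const, nsmul_eq_mul]
        refine mul_le_mul_of_nonneg_right ?_ (by positivity)
        exact_mod_cast card_filter_range_mod_eq_le he _
    _ = η ^ 2 * 2 ^ (q - e) * 2 ^ (q - r) := by ring

/-- **Pair weight, `ℓ¹` branch** ((2.18)–(2.19)): with progression bounds
`∑_{k ≡ b (2^m)} c(k) ≤ P(m)`, on a residue class `k ≡ a (mod 2^e)`,
`∑_{k ≡ a} c(k) ∑_{k' ≡ -k (2^r)} c(k') ≤ P(e) P(r)`. [cite: Bourgain2013MoebiusWalsh, §2 (2.18)] -/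
theorem pairWeight_le_prog {q e r : ℕ} (he : e ≤ q) (hr : r ≤ q) (c : ℕ → ℝ) (hc0 : ∀ k, 0 ≤ c k)
    (P : ℕ → ℝ)
    (hP : ∀ m, m ≤ q → ∀ b, ∑ k ∈ (range (2 ^ q)).filter (fun k => k % 2 ^ m = b % 2 ^ m), c k ≤ P m)
    (a : ℕ) :
    ∑ k ∈ (range (2 ^ q)).filter (fun k => k % 2 ^ e = a % 2 ^ e),
        c k * ∑ k' ∈ (range (2 ^ q)).filter (fun k' => 2 ^ r ∣ k + k'), c k' ≤ P e * P r := by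
  have hPr : 0 ≤ P r := le_trans (Finset.sum_nonneg fun k _ => hc0 k) (hP r hr 0)
  have hinner : ∀ k ∈ (range (2 ^ q)).filter (fun k => k % 2 ^ e = a % 2 ^ e),
      c k * ∑ k' ∈ (range (2 ^ q)).filter (fun k' => 2 ^ r ∣ k + k'), c k' ≤ c k * P r := by
    intro k hk
    have hkq : k ≤ 2 ^ q := (Finset.mem_range.1 (Finset.mem_filter.1 hk).1).le
    refine mul_le_mul_of_nonneg_left ?_ (hc0 k)
    have hset : (range (2 ^ q)).filter (fun k' => 2 ^ r ∣ k + k') =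
        (range (2 ^ q)).filter (fun k' => k' % 2 ^ r = (2 ^ q - k) % 2 ^ r) :=
      Finset.filter_congr fun k' _ => dvd_add_iff_mod_eq hr hkq
    rw [hset]
    exact hP r hr _
  calc ∑ k ∈ (range (2 ^ q)).filter (fun k => k % 2 ^ e = a % 2 ^ e),
        c k * ∑ k' ∈ (range (2 ^ q)).filter (fun k' => 2 ^ r ∣ k + k'), c k'
      ≤ ∑ k ∈ (range (2 ^ q)).filter (fun k => k % 2 ^ e = a % 2 ^ e), c k * P r :=
        Finset.sum_le_sum hinner
    _ = (∑ k ∈ (range (2 ^ q)).filter (fun k => k % 2 ^ e = a % 2 ^ e), c k) * P r := by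
        rw [Finset.sum_mul]
    _ ≤ P e * P r := mul_le_mul_of_nonneg_right (hP e he a) hPr

/-! ### The resonant sum over one `2^r`-progression structure -/

/-- **The resonant pair sum** ((2.17)–(2.22)): for `r ≤ q`, `1 ≤ h = 2^s h₁` (`h₁` odd),
`e = r - s` (truncated) and `V ≥ 0`,
`∑_{k<Q} c(k) min(V, 1/(2‖kh/2^r‖)) ∑_{k' ≡ -k (2^r)} c(k') ≤ min(η² 2^{q-e} 2^{q-r}, P(e)P(r)) · (2^{v₂ h₁ … } …)`,
precisely `≤ min(η² 2^{q-e} 2^{q-r}, P(e) P(r)) (2V + 2^e (1 + log 2^e))`: the kernel only depends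
on `k h₁ mod 2^e`, and over the `2^e` classes it sums to at most `2V + 2^e(1 + log 2^e)`.
[cite: Bourgain2013MoebiusWalsh, §2 (2.17)–(2.22)] -/
theorem resonant_pairSum_le {q r h : ℕ} (hr : r ≤ q) (hh : h ≠ 0) (c : ℕ → ℝ)
    (hc0 : ∀ k, 0 ≤ c k) {η : ℝ} (hη : ∀ k, c k ≤ η) (P : ℕ → ℝ)
    (hP : ∀ m, m ≤ q → ∀ b, ∑ k ∈ (range (2 ^ q)).filter (fun k => k % 2 ^ m = b % 2 ^ m), c k ≤ P m)
    {V : ℝ} (hV : 0 ≤ V) :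
    ∑ k ∈ range (2 ^ q), c k * geomBound V ((k : ℝ) * h / 2 ^ r) *
        ∑ k' ∈ (range (2 ^ q)).filter (fun k' => 2 ^ r ∣ k + k'), c k' ≤
      min (η ^ 2 * 2 ^ (q - (r - h.factorization 2)) * 2 ^ (q - r))
          (P (r - h.factorization 2) * P r) *
        (2 * V + 2 ^ (r - h.factorization 2) * (1 + Real.log (2 ^ (r - h.factorization 2)))) := by
  obtain ⟨h₁, hodd, hfac⟩ := exists_eq_two_pow_factorization_mul_odd hh
  set s := h.factorization 2 with hs
  set e := r - s with he
  have heq : e ≤ q := le_trans (Nat.sub_le r s) hr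
  set W : ℝ := min (η ^ 2 * 2 ^ (q - e) * 2 ^ (q - r)) (P e * P r) with hW
  set F : ℕ → ℝ := fun k => ∑ k' ∈ (range (2 ^ q)).filter (fun k' => 2 ^ r ∣ k + k'), c k' with hF
  have hF0 : ∀ k, 0 ≤ F k := fun k => Finset.sum_nonneg fun k' _ => hc0 k'
  -- the kernel only depends on `k h₁ mod 2^e`
  set ψ : ℕ → ℝ := fun a => geomBound V ((((h₁ * a) % 2 ^ e : ℕ) : ℝ) / 2 ^ e) with hψ
  have hker : ∀ k : ℕ, geomBound V ((k : ℝ) * h / 2 ^ r) = ψ (k % 2 ^ e) := by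
    intro k
    simp only [hψ]
    -- `kh/2^r = k h₁ 2^s / 2^r`
    rcases le_or_gt r s with hrs | hrs
    · -- integer phase
      have he0 : e = 0 := by rw [he]; omega
      rw [he0]
      simp only [pow_zero, Nat.mod_one, Nat.cast_zero, zero_div]
      have : (k : ℝ) * h / 2 ^ r = 0 + ((k * h₁ * 2 ^ (s - r) : ℕ) : ℝ) := by
        rw [hfac]; push_cast
        rw [show (2 : ℝ) ^ s = 2 ^ r * 2 ^ (s - r) by rw [← pow_add, Nat.add_sub_cancel' hrs]]
        field_simp
        ring
      rw [this, geomBound_add_nat]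
    · have hers : e + s = r := by rw [he]; omega
      have h2r : (2 : ℝ) ^ r = 2 ^ e * 2 ^ s := by rw [← pow_add, hers]
      have hkm := Nat.div_add_mod (h₁ * k) (2 ^ e)
      have hmod : (h₁ * k) % 2 ^ e = (h₁ * (k % 2 ^ e)) % 2 ^ e := by
        conv_rhs => rw [Nat.mul_mod, Nat.mod_mod, ← Nat.mul_mod]
      have : (k : ℝ) * h / 2 ^ r =
          (((h₁ * (k % 2 ^ e)) % 2 ^ e : ℕ) : ℝ) / 2 ^ e + ((h₁ * k / 2 ^ e : ℕ) : ℝ) := by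
        rw [← hmod, hfac, h2r]
        have hE : (2 : ℝ) ^ e ≠ 0 := by positivity
        have hS : (2 : ℝ) ^ s ≠ 0 := by positivity
        have hk : ((h₁ * k : ℕ) : ℝ) = 2 ^ e * ((h₁ * k / 2 ^ e : ℕ) : ℝ) + ((h₁ * k % 2 ^ e : ℕ) : ℝ) := by
          exact_mod_cast hkm.symm
        field_simp
        push_cast at hk ⊢
        linear_combination (2:ℝ) ^ s * hk
      rw [this, geomBound_add_nat]
  -- regroup by the class of `k` modulo `2^e`
  have hLHS : ∑ k ∈ range (2 ^ q), c k * geomBound V ((k : ℝ) * h / 2 ^ r) * F k =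
      ∑ a ∈ range (2 ^ e), ψ a *
        ∑ k ∈ (range (2 ^ q)).filter (fun k => k % 2 ^ e = a % 2 ^ e), c k * F k := by
    rw [← Finset.sum_fiberwise_of_maps_to (g := fun k => k % 2 ^ e) (t := range (2 ^ e))
      (fun k _ => Finset.mem_range.2 (Nat.mod_lt _ (Nat.two_pow_pos e)))]
    refine Finset.sum_congr rfl fun a ha => ?_
    have ha' : a % 2 ^ e = a := Nat.mod_eq_of_lt (Finset.mem_range.1 ha)
    rw [Finset.mul_sum]
    refine Finset.sum_congr (by rw [ha']) fun k hk => ?_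
    rw [Finset.mem_filter] at hk
    rw [hker k, hk.2, ha']
    ring
  rw [hLHS]
  -- uniform bound on the class weights
  have hWa : ∀ a, ∑ k ∈ (range (2 ^ q)).filter (fun k => k % 2 ^ e = a % 2 ^ e), c k * F k ≤ W := by
    intro a
    refine le_min ?_ ?_
    · exact pairWeight_le_sup heq hr c hc0 hη a
    · exact pairWeight_le_prog heq hr c hc0 P hP a
  have hψ0 : ∀ a, 0 ≤ ψ a := fun a => geomBound_nonneg hV _
  have hW0 : 0 ≤ W := le_trans (Finset.sum_nonneg fun k _ => mul_nonneg (hc0 k) (hF0 k)) (hWa 0)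
  -- the kernel over the classes
  have hψsum : ∑ a ∈ range (2 ^ e), ψ a ≤ 2 * V + 2 ^ e * (1 + Real.log (2 ^ e)) := by
    have e1 : ∀ a : ℕ, ψ a = geomBound V ((((h₁ * a : ℕ) : ℝ)) / 2 ^ e + 0) := by
      intro a
      simp only [hψ]
      have hd := Nat.div_add_mod (h₁ * a) (2 ^ e)
      have : (((h₁ * a : ℕ) : ℝ)) / 2 ^ e + 0 =
          (((h₁ * a) % 2 ^ e : ℕ) : ℝ) / 2 ^ e + ((h₁ * a / 2 ^ e : ℕ) : ℝ) := by
        have hk : ((h₁ * a : ℕ) : ℝ) = 2 ^ e * ((h₁ * a / 2 ^ e : ℕ) : ℝ) + ((h₁ * a % 2 ^ e : ℕ) : ℝ) := by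
          exact_mod_cast hd.symm
        rw [hk]; field_simp; ring
      rw [this, geomBound_add_nat]
    rw [Finset.sum_congr rfl fun a _ => e1 a]
    have hodd0 : h₁ ≠ 0 := by rintro rfl; exact (Nat.not_odd_zero hodd).elim
    have h := sum_range_geomBound_mul_div_le hodd0 e hV 0
    have hf1 : h₁.factorization 2 = 0 := Nat.factorization_eq_zero_of_not_dvd
      (fun h2 => (Nat.not_even_iff_odd.2 hodd) (even_iff_two_dvd.2 h2))
    rw [hf1, zero_add, pow_one] at h
    exact h
  calc ∑ a ∈ range (2 ^ e), ψ a * ∑ k ∈ (range (2 ^ q)).filter (fun k => k % 2 ^ e = a % 2 ^ e), c k * F k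
      ≤ ∑ a ∈ range (2 ^ e), ψ a * W :=
        Finset.sum_le_sum fun a _ => mul_le_mul_of_nonneg_left (hWa a) (hψ0 a)
    _ = W * ∑ a ∈ range (2 ^ e), ψ a := by rw [← Finset.sum_mul, mul_comm]
    _ ≤ W * (2 * V + 2 ^ e * (1 + Real.log (2 ^ e))) := mul_le_mul_of_nonneg_left hψsum hW0


/-! ### The `K = 0` core count -/

/-- The `2`-adic valuation of a non-zero residue below `2^q` is `< q`. [folklore] -/
theorem factorization_two_lt_of_lt {q d : ℕ} (hd0 : d ≠ 0) (hd : d < 2 ^ q) :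
    d.factorization 2 < q := by
  have h := Nat.ordProj_le 2 hd0
  exact (Nat.pow_lt_pow_iff_right (by norm_num)).1 (lt_of_le_of_lt h hd)

/-- **Type-II core count, unshifted window (`K = 0`)** — Bourgain 2013, §2, (2.11)–(2.22) as one
abstract inequality. Let `q ∈ ℕ` (`Q = 2^q`), `c : ℕ → ℝ` with `0 ≤ c ≤ η` and progression bounds
`∑_{k<Q, k ≡ b (2^m)} c(k) ≤ P(m)` for all `m ≤ q`, `b`; let `M ≥ 0`, `N₁ ≤ N₂` (`N = N₂ - N₁`),
`H ∈ ℕ`. Then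
`∑_{1≤h<H} ∑_{k,k'<Q} c(k)c(k') ∑_{N₁≤n<N₂} min(M, 1/(2‖(k(n+h)+k'n)/Q‖))`
`≤ H·N η²(2HM + Q(1+log Q))`  (diagonal, (2.13)–(2.14))
`+ ∑_{h} ∑_{r<q} (N + 2^{q-r}) [ (1+log Q) P(0)P(r)`  (flat, (2.15))
`+ 2 min(η² 2^{q-e} 2^{q-r}, P(e)P(r)) (2M/2^{q-r} + 2^e(1 + log 2^e)) ]`, `e = r - v₂(h)`
(resonant, (2.16)–(2.22)). [cite: Bourgain2013MoebiusWalsh, §2 (2.11)–(2.22)] -/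
theorem typeII_core_zero (q : ℕ) (c : ℕ → ℝ) (hc0 : ∀ k, 0 ≤ c k) {η : ℝ} (hη : ∀ k, c k ≤ η)
    (P : ℕ → ℝ)
    (hP : ∀ m, m ≤ q → ∀ b, ∑ k ∈ (range (2 ^ q)).filter (fun k => k % 2 ^ m = b % 2 ^ m), c k ≤ P m)
    {M : ℝ} (hM : 0 ≤ M) {N₁ N₂ : ℕ} (hN : N₁ ≤ N₂) (H : ℕ) :
    ∑ h ∈ Ico 1 H, ∑ k ∈ range (2 ^ q), ∑ k' ∈ range (2 ^ q), c k * c k' *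
        ∑ n ∈ Ico N₁ N₂, geomBound M (((k : ℝ) * (n + h) + k' * n) / 2 ^ q) ≤
      H * (((N₂ : ℝ) - N₁) * η ^ 2 * (2 * H * M + 2 ^ q * (1 + Real.log (2 ^ q)))) +
      ∑ h ∈ Ico 1 H, ∑ r ∈ range q, (((N₂ : ℝ) - N₁) + 2 ^ (q - r)) *
        ((1 + Real.log (2 ^ q)) * (P 0 * P r) +
          2 * (min (η ^ 2 * 2 ^ (q - (r - h.factorization 2)) * 2 ^ (q - r))
                (P (r - h.factorization 2) * P r) *
            (2 * (M / 2 ^ (q - r)) + 2 ^ (r - h.factorization 2) *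
              (1 + Real.log (2 ^ (r - h.factorization 2)))))) := by
  set N : ℝ := (N₂ : ℝ) - N₁ with hNdef
  set lam : ℝ := 1 + Real.log (2 ^ q) with hlam
  have hN0 : 0 ≤ N := by
    have h1 : (N₁ : ℝ) ≤ N₂ := by exact_mod_cast hN
    rw [hNdef]; linarith
  have hη0 : 0 ≤ η := le_trans (hc0 0) (hη 0)
  have hlog : ∀ n : ℕ, 0 ≤ Real.log ((2 : ℝ) ^ n) := fun n =>
    Real.log_nonneg (one_le_pow₀ (by norm_num))
  have hlam1 : 1 ≤ lam := by have := hlog q; rw [hlam]; linarith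
  have hlogmono : ∀ {a b : ℕ}, a ≤ b → Real.log ((2 : ℝ) ^ a) ≤ Real.log ((2 : ℝ) ^ b) :=
    fun hab => Real.log_le_log (by positivity) (pow_le_pow_right₀ (by norm_num) hab)
  have hP0 : ∀ m, m ≤ q → 0 ≤ P m := fun m hm =>
    le_trans (Finset.sum_nonneg fun k _ => hc0 k) (hP m hm 0)
  have hcardN : ((Ico N₁ N₂).card : ℝ) = N := by
    rw [Nat.card_Ico, Nat.cast_sub hN]
  -- the diagonal kernel sum
  have hdiagker : ∀ h, 1 ≤ h → h < H →
      ∑ k ∈ range (2 ^ q), geomBound M ((k : ℝ) * h / 2 ^ q) ≤ 2 * H * M + 2 ^ q * lam := by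
    intro h h1 hH
    have hh0 : h ≠ 0 := by omega
    have e : ∀ k : ℕ, geomBound M ((k : ℝ) * h / 2 ^ q) =
        geomBound M ((((h * k : ℕ) : ℝ)) / 2 ^ q + 0) := by
      intro k; congr 1; push_cast; ring
    rw [Finset.sum_congr rfl fun k _ => e k]
    refine (sum_range_geomBound_mul_div_le hh0 q hM 0).trans ?_
    have h2 : (2 : ℝ) ^ (h.factorization 2 + 1) ≤ 2 * H := by
      have := Nat.ordProj_le 2 hh0
      have : ((2 ^ h.factorization 2 : ℕ) : ℝ) ≤ h := by exact_mod_cast this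
      have hh : (h : ℝ) ≤ H := by exact_mod_cast hH.le
      rw [pow_succ]; push_cast at this ⊢; nlinarith
    have := mul_le_mul_of_nonneg_right h2 hM
    linarith
  -- the bound for one shift `h`
  have hS : ∀ h ∈ Ico 1 H,
      ∑ k ∈ range (2 ^ q), ∑ k' ∈ range (2 ^ q), c k * c k' *
          ∑ n ∈ Ico N₁ N₂, geomBound M (((k : ℝ) * (n + h) + k' * n) / 2 ^ q) ≤
        N * η ^ 2 * (2 * H * M + 2 ^ q * lam) +
        ∑ r ∈ range q, (N + 2 ^ (q - r)) *
          (lam * (P 0 * P r) +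
            2 * (min (η ^ 2 * 2 ^ (q - (r - h.factorization 2)) * 2 ^ (q - r))
                  (P (r - h.factorization 2) * P r) *
              (2 * (M / 2 ^ (q - r)) + 2 ^ (r - h.factorization 2) *
                (1 + Real.log (2 ^ (r - h.factorization 2)))))) := by
    intro h hh
    rw [Finset.mem_Ico] at hh
    have hh0 : h ≠ 0 := by omega
    -- the majorant of the `n`-sum for a pair `(k, k')`
    set v : ℕ → ℕ → ℕ := fun k k' => ((k + k') % 2 ^ q).factorization 2 with hv
    set B : ℕ → ℕ → ℝ := fun r k => (N / 2 ^ (q - r) + 1) *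
      (2 * 2 ^ (q - r) * geomBound (M / 2 ^ (q - r)) ((k : ℝ) * h / 2 ^ r) + 2 ^ (q - r) * lam) with hB
    have hB0 : ∀ r k, 0 ≤ B r k := by
      intro r k
      have : 0 ≤ geomBound (M / 2 ^ (q - r)) ((k : ℝ) * h / 2 ^ r) := geomBound_nonneg (by positivity) _
      positivity
    have hG : ∀ k ∈ range (2 ^ q), ∀ k' ∈ range (2 ^ q),
        ∑ n ∈ Ico N₁ N₂, geomBound M (((k : ℝ) * (n + h) + k' * n) / 2 ^ q) ≤
          if 2 ^ q ∣ k + k' then N * geomBound M ((k : ℝ) * h / 2 ^ q) else B (v k k') k := by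
      intro k hk k' _
      split_ifs with hdvd
      · rw [Finset.sum_congr rfl fun n _ => geomBound_pair_of_dvd hdvd M n h, Finset.sum_const,
          nsmul_eq_mul, hcardN]
      · have hd0 : (k + k') % 2 ^ q ≠ 0 := fun h0 => hdvd (Nat.dvd_of_mod_eq_zero h0)
        have hdlt : (k + k') % 2 ^ q < 2 ^ q := Nat.mod_lt _ (Nat.two_pow_pos q)
        obtain ⟨d₁, hd₁, hdeq⟩ := exists_eq_two_pow_factorization_mul_odd hd0
        have hrq : v k k' < q := factorization_two_lt_of_lt hd0 hdlt
        have h1 := sum_Ico_geomBound_pair_le hrq.le hd₁ hdeq hM hN h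
        refine h1.trans ?_
        simp only [hB]
        refine mul_le_mul_of_nonneg_left ?_ (by positivity)
        have := hlogmono (Nat.sub_le q (v k k'))
        have hg : 0 ≤ geomBound (M / 2 ^ (q - v k k')) ((k : ℝ) * h / 2 ^ (v k k')) :=
          geomBound_nonneg (by positivity) _
        rw [hlam]
        nlinarith [hg, pow_pos (show (0:ℝ) < 2 by norm_num) (q - v k k')]
    -- Step 2: insert the majorant and split diagonal / off-diagonal
    have hstep2 : ∑ k ∈ range (2 ^ q), ∑ k' ∈ range (2 ^ q), c k * c k' *
          ∑ n ∈ Ico N₁ N₂, geomBound M (((k : ℝ) * (n + h) + k' * n) / 2 ^ q) ≤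
        ∑ k ∈ range (2 ^ q), (∑ k' ∈ (range (2 ^ q)).filter (fun k' => 2 ^ q ∣ k + k'),
            c k * c k' * (N * geomBound M ((k : ℝ) * h / 2 ^ q)) +
          ∑ k' ∈ (range (2 ^ q)).filter (fun k' => ¬ 2 ^ q ∣ k + k'),
            c k * c k' * B (v k k') k) := by
      refine Finset.sum_le_sum fun k hk => ?_
      rw [← Finset.sum_ite]
      refine Finset.sum_le_sum fun k' hk' => ?_
      have := hG k hk k' hk'
      split_ifs at this ⊢ with hd
      · exact mul_le_mul_of_nonneg_left this (mul_nonneg (hc0 k) (hc0 k'))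
      · exact mul_le_mul_of_nonneg_left this (mul_nonneg (hc0 k) (hc0 k'))
    -- Step 3: the diagonal
    have hdiag : ∑ k ∈ range (2 ^ q), ∑ k' ∈ (range (2 ^ q)).filter (fun k' => 2 ^ q ∣ k + k'),
        c k * c k' * (N * geomBound M ((k : ℝ) * h / 2 ^ q)) ≤ N * η ^ 2 * (2 * H * M + 2 ^ q * lam) := by
      have hin : ∀ k ∈ range (2 ^ q), ∑ k' ∈ (range (2 ^ q)).filter (fun k' => 2 ^ q ∣ k + k'),
          c k * c k' * (N * geomBound M ((k : ℝ) * h / 2 ^ q)) ≤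
            η * η * (N * geomBound M ((k : ℝ) * h / 2 ^ q)) := by
        intro k hk
        have hkq : k ≤ 2 ^ q := (Finset.mem_range.1 hk).le
        have hg0 : 0 ≤ N * geomBound M ((k : ℝ) * h / 2 ^ q) := mul_nonneg hN0 (geomBound_nonneg hM _)
        have e : ∑ k' ∈ (range (2 ^ q)).filter (fun k' => 2 ^ q ∣ k + k'),
            c k * c k' * (N * geomBound M ((k : ℝ) * h / 2 ^ q)) =
            c k * (N * geomBound M ((k : ℝ) * h / 2 ^ q)) *
              ∑ k' ∈ (range (2 ^ q)).filter (fun k' => 2 ^ q ∣ k + k'), c k' := by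
          rw [Finset.mul_sum]; refine Finset.sum_congr rfl fun k' _ => ?_; ring
        rw [e]
        have hsum : ∑ k' ∈ (range (2 ^ q)).filter (fun k' => 2 ^ q ∣ k + k'), c k' ≤ η := by
          have hset : (range (2 ^ q)).filter (fun k' => 2 ^ q ∣ k + k') =
              (range (2 ^ q)).filter (fun k' => k' % 2 ^ q = (2 ^ q - k) % 2 ^ q) :=
            Finset.filter_congr fun k' _ => dvd_add_iff_mod_eq le_rfl hkq
          rw [hset]
          calc ∑ k' ∈ (range (2 ^ q)).filter (fun k' => k' % 2 ^ q = (2 ^ q - k) % 2 ^ q), c k'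
              ≤ ∑ _k' ∈ (range (2 ^ q)).filter (fun k' => k' % 2 ^ q = (2 ^ q - k) % 2 ^ q), η :=
                Finset.sum_le_sum fun k' _ => hη k'
            _ ≤ η := by
                rw [Finset.sum_const, nsmul_eq_mul]
                have hc := card_filter_range_mod_eq_le (le_refl q) ((2 ^ q - k) % 2 ^ q)
                rw [Nat.sub_self, pow_zero] at hc
                have : (((range (2 ^ q)).filter (fun k' => k' % 2 ^ q = (2 ^ q - k) % 2 ^ q)).card : ℝ) ≤ 1 := by
                  exact_mod_cast hc
                nlinarith
        calc c k * (N * geomBound M ((k : ℝ) * h / 2 ^ q)) *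
              ∑ k' ∈ (range (2 ^ q)).filter (fun k' => 2 ^ q ∣ k + k'), c k'
            ≤ η * (N * geomBound M ((k : ℝ) * h / 2 ^ q)) * η := by
              refine mul_le_mul (mul_le_mul_of_nonneg_right (hη k) hg0) hsum
                (Finset.sum_nonneg fun k' _ => hc0 k') (by positivity)
          _ = η * η * (N * geomBound M ((k : ℝ) * h / 2 ^ q)) := by ring
      calc ∑ k ∈ range (2 ^ q), ∑ k' ∈ (range (2 ^ q)).filter (fun k' => 2 ^ q ∣ k + k'),
            c k * c k' * (N * geomBound M ((k : ℝ) * h / 2 ^ q))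
          ≤ ∑ k ∈ range (2 ^ q), η * η * (N * geomBound M ((k : ℝ) * h / 2 ^ q)) :=
            Finset.sum_le_sum hin
        _ = N * η ^ 2 * ∑ k ∈ range (2 ^ q), geomBound M ((k : ℝ) * h / 2 ^ q) := by
            rw [Finset.mul_sum]; refine Finset.sum_congr rfl fun k _ => ?_; ring
        _ ≤ N * η ^ 2 * (2 * H * M + 2 ^ q * lam) :=
            mul_le_mul_of_nonneg_left (hdiagker h hh.1 hh.2) (by positivity)
    -- Step 4: the off-diagonal part, regrouped by `r = v₂((k+k') mod Q)`
    have hoff : ∑ k ∈ range (2 ^ q), ∑ k' ∈ (range (2 ^ q)).filter (fun k' => ¬ 2 ^ q ∣ k + k'),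
        c k * c k' * B (v k k') k ≤
        ∑ r ∈ range q, ∑ k ∈ range (2 ^ q), ∑ k' ∈ (range (2 ^ q)).filter (fun k' => 2 ^ r ∣ k + k'),
          c k * c k' * B r k := by
      rw [Finset.sum_comm]
      refine Finset.sum_le_sum fun k hk => ?_
      have hmaps : ∀ k' ∈ (range (2 ^ q)).filter (fun k' => ¬ 2 ^ q ∣ k + k'), v k k' ∈ range q := by
        intro k' hk'
        rw [Finset.mem_filter] at hk'
        have hd0 : (k + k') % 2 ^ q ≠ 0 := fun h0 => hk'.2 (Nat.dvd_of_mod_eq_zero h0)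
        exact Finset.mem_range.2 (factorization_two_lt_of_lt hd0 (Nat.mod_lt _ (Nat.two_pow_pos q)))
      rw [← Finset.sum_fiberwise_of_maps_to hmaps]
      refine Finset.sum_le_sum fun r hr => ?_
      have hsub : ((range (2 ^ q)).filter (fun k' => ¬ 2 ^ q ∣ k + k')).filter (fun k' => v k k' = r) ⊆
          (range (2 ^ q)).filter (fun k' => 2 ^ r ∣ k + k') := by
        intro k' hk'
        rw [Finset.mem_filter, Finset.mem_filter] at hk'
        rw [Finset.mem_filter]
        refine ⟨hk'.1.1, ?_⟩
        have h1 : 2 ^ r ∣ (k + k') % 2 ^ q := by rw [← hk'.2]; exact Nat.ordProj_dvd _ _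
        have h2 : 2 ^ r ∣ 2 ^ q * ((k + k') / 2 ^ q) :=
          Dvd.dvd.mul_right (pow_dvd_pow 2 (Finset.mem_range.1 hr).le) _
        have := Nat.div_add_mod (k + k') (2 ^ q)
        rw [← this]
        exact Nat.dvd_add h2 h1
      calc ∑ k' ∈ ((range (2 ^ q)).filter (fun k' => ¬ 2 ^ q ∣ k + k')).filter (fun k' => v k k' = r),
            c k * c k' * B (v k k') k
          = ∑ k' ∈ ((range (2 ^ q)).filter (fun k' => ¬ 2 ^ q ∣ k + k')).filter (fun k' => v k k' = r),
            c k * c k' * B r k := by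
              refine Finset.sum_congr rfl fun k' hk' => ?_
              rw [(Finset.mem_filter.1 hk').2]
        _ ≤ ∑ k' ∈ (range (2 ^ q)).filter (fun k' => 2 ^ r ∣ k + k'), c k * c k' * B r k :=
              Finset.sum_le_sum_of_subset_of_nonneg hsub fun k' _ _ =>
                mul_nonneg (mul_nonneg (hc0 k) (hc0 k')) (hB0 r k)
    -- Step 5: each `r`
    have hr_bound : ∀ r ∈ range q,
        ∑ k ∈ range (2 ^ q), ∑ k' ∈ (range (2 ^ q)).filter (fun k' => 2 ^ r ∣ k + k'),
          c k * c k' * B r k ≤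
        (N + 2 ^ (q - r)) *
          (lam * (P 0 * P r) +
            2 * (min (η ^ 2 * 2 ^ (q - (r - h.factorization 2)) * 2 ^ (q - r))
                  (P (r - h.factorization 2) * P r) *
              (2 * (M / 2 ^ (q - r)) + 2 ^ (r - h.factorization 2) *
                (1 + Real.log (2 ^ (r - h.factorization 2)))))) := by
      intro r hr
      have hrq : r ≤ q := (Finset.mem_range.1 hr).le
      set F : ℕ → ℝ := fun k => ∑ k' ∈ (range (2 ^ q)).filter (fun k' => 2 ^ r ∣ k + k'), c k' with hF
      have hQr : (0 : ℝ) < 2 ^ (q - r) := by positivity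
      -- rewrite the left side
      have e0 : ∀ k, ∑ k' ∈ (range (2 ^ q)).filter (fun k' => 2 ^ r ∣ k + k'), c k * c k' * B r k =
          (N / 2 ^ (q - r) + 1) * (2 ^ (q - r) * lam * (c k * F k) +
            2 * 2 ^ (q - r) * (c k * geomBound (M / 2 ^ (q - r)) ((k : ℝ) * h / 2 ^ r) * F k)) := by
        intro k
        have e00 : ∑ k' ∈ (range (2 ^ q)).filter (fun k' => 2 ^ r ∣ k + k'), c k * c k' * B r k =
            (c k * B r k) * F k := by
          rw [hF]; dsimp only; rw [Finset.mul_sum]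
          exact Finset.sum_congr rfl fun k' _ => by ring
        rw [e00, hB]; dsimp only; ring
      have e1 : ∑ k ∈ range (2 ^ q), ∑ k' ∈ (range (2 ^ q)).filter (fun k' => 2 ^ r ∣ k + k'),
          c k * c k' * B r k =
          (N / 2 ^ (q - r) + 1) * (2 ^ (q - r) * lam * ∑ k ∈ range (2 ^ q), c k * F k +
            2 * 2 ^ (q - r) * ∑ k ∈ range (2 ^ q),
              c k * geomBound (M / 2 ^ (q - r)) ((k : ℝ) * h / 2 ^ r) * F k) := by
        rw [Finset.sum_congr rfl (fun k _ => e0 k), ← Finset.mul_sum, Finset.sum_add_distrib,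
          ← Finset.mul_sum, ← Finset.mul_sum]
      rw [e1]
      -- flat pair sum
      have hflat : ∑ k ∈ range (2 ^ q), c k * F k ≤ P 0 * P r := by
        have h0 := pairWeight_le_prog (e := 0) (Nat.zero_le q) hrq c hc0 P hP 0
        have hset : (range (2 ^ q)).filter (fun k => k % 2 ^ 0 = 0 % 2 ^ 0) = range (2 ^ q) := by
          refine Finset.filter_true_of_mem fun k _ => ?_
          simp only [pow_zero, Nat.mod_one]
        rw [hset] at h0
        exact h0
      -- resonant pair sum
      have hres := resonant_pairSum_le hrq hh0 c hc0 hη P hP (V := M / 2 ^ (q - r)) (by positivity)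
      have hfac : (N / 2 ^ (q - r) + 1) = (N + 2 ^ (q - r)) / 2 ^ (q - r) := by
        field_simp
      rw [hfac]
      have hmin0 : 0 ≤ min (η ^ 2 * 2 ^ (q - (r - h.factorization 2)) * 2 ^ (q - r))
          (P (r - h.factorization 2) * P r) :=
        le_min (by positivity) (mul_nonneg (hP0 _ (le_trans (Nat.sub_le _ _) hrq)) (hP0 r hrq))
      have hK0 : 0 ≤ 2 * (M / 2 ^ (q - r)) + 2 ^ (r - h.factorization 2) *
          (1 + Real.log (2 ^ (r - h.factorization 2))) := by
        have := hlog (r - h.factorization 2); positivity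
      rw [div_mul_eq_mul_div, div_le_iff₀ hQr]
      have hlam0 : 0 ≤ lam := by linarith
      have hsum0 : 0 ≤ ∑ k ∈ range (2 ^ q), c k * geomBound (M / 2 ^ (q - r)) ((k : ℝ) * h / 2 ^ r) * F k :=
        Finset.sum_nonneg fun k _ => mul_nonneg (mul_nonneg (hc0 k) (geomBound_nonneg (by positivity) _))
          (Finset.sum_nonneg fun k' _ => hc0 k')
      have h1 : 2 ^ (q - r) * lam * ∑ k ∈ range (2 ^ q), c k * F k ≤ 2 ^ (q - r) * lam * (P 0 * P r) :=
        mul_le_mul_of_nonneg_left hflat (by positivity)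
      have h2 : 2 * 2 ^ (q - r) * ∑ k ∈ range (2 ^ q),
          c k * geomBound (M / 2 ^ (q - r)) ((k : ℝ) * h / 2 ^ r) * F k ≤
          2 * 2 ^ (q - r) * (min (η ^ 2 * 2 ^ (q - (r - h.factorization 2)) * 2 ^ (q - r))
            (P (r - h.factorization 2) * P r) *
            (2 * (M / 2 ^ (q - r)) + 2 ^ (r - h.factorization 2) *
              (1 + Real.log (2 ^ (r - h.factorization 2))))) :=
        mul_le_mul_of_nonneg_left hres (by positivity)
      have hNQ : 0 ≤ N + 2 ^ (q - r) := by positivity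
      calc (N + 2 ^ (q - r)) * (2 ^ (q - r) * lam * ∑ k ∈ range (2 ^ q), c k * F k +
            2 * 2 ^ (q - r) * ∑ k ∈ range (2 ^ q),
              c k * geomBound (M / 2 ^ (q - r)) ((k : ℝ) * h / 2 ^ r) * F k)
          ≤ (N + 2 ^ (q - r)) * (2 ^ (q - r) * lam * (P 0 * P r) +
            2 * 2 ^ (q - r) * (min (η ^ 2 * 2 ^ (q - (r - h.factorization 2)) * 2 ^ (q - r))
              (P (r - h.factorization 2) * P r) *
              (2 * (M / 2 ^ (q - r)) + 2 ^ (r - h.factorization 2) *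
                (1 + Real.log (2 ^ (r - h.factorization 2)))))) :=
            mul_le_mul_of_nonneg_left (add_le_add h1 h2) hNQ
        _ = (N + 2 ^ (q - r)) *
            (lam * (P 0 * P r) +
              2 * (min (η ^ 2 * 2 ^ (q - (r - h.factorization 2)) * 2 ^ (q - r))
                    (P (r - h.factorization 2) * P r) *
                (2 * (M / 2 ^ (q - r)) + 2 ^ (r - h.factorization 2) *
                  (1 + Real.log (2 ^ (r - h.factorization 2)))))) * 2 ^ (q - r) := by ring
    -- assemble the `h`-bound
    calc ∑ k ∈ range (2 ^ q), ∑ k' ∈ range (2 ^ q), c k * c k' *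
          ∑ n ∈ Ico N₁ N₂, geomBound M (((k : ℝ) * (n + h) + k' * n) / 2 ^ q)
        ≤ _ := hstep2
      _ = ∑ k ∈ range (2 ^ q), ∑ k' ∈ (range (2 ^ q)).filter (fun k' => 2 ^ q ∣ k + k'),
            c k * c k' * (N * geomBound M ((k : ℝ) * h / 2 ^ q)) +
          ∑ k ∈ range (2 ^ q), ∑ k' ∈ (range (2 ^ q)).filter (fun k' => ¬ 2 ^ q ∣ k + k'),
            c k * c k' * B (v k k') k := Finset.sum_add_distrib
      _ ≤ N * η ^ 2 * (2 * H * M + 2 ^ q * lam) +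
          ∑ r ∈ range q, ∑ k ∈ range (2 ^ q), ∑ k' ∈ (range (2 ^ q)).filter (fun k' => 2 ^ r ∣ k + k'),
            c k * c k' * B r k := add_le_add hdiag hoff
      _ ≤ _ := by
          refine add_le_add le_rfl (Finset.sum_le_sum hr_bound)
  -- sum over `h`
  have hcardH : ((Ico 1 H).card : ℝ) ≤ H := by
    rw [Nat.card_Ico]; exact_mod_cast Nat.sub_le H 1
  have hA0 : 0 ≤ N * η ^ 2 * (2 * H * M + 2 ^ q * lam) := by
    have : 0 ≤ lam := by linarith
    positivity
  calc ∑ h ∈ Ico 1 H, ∑ k ∈ range (2 ^ q), ∑ k' ∈ range (2 ^ q), c k * c k' *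
        ∑ n ∈ Ico N₁ N₂, geomBound M (((k : ℝ) * (n + h) + k' * n) / 2 ^ q)
      ≤ ∑ h ∈ Ico 1 H, (N * η ^ 2 * (2 * H * M + 2 ^ q * lam) +
        ∑ r ∈ range q, (N + 2 ^ (q - r)) *
          (lam * (P 0 * P r) +
            2 * (min (η ^ 2 * 2 ^ (q - (r - h.factorization 2)) * 2 ^ (q - r))
                  (P (r - h.factorization 2) * P r) *
              (2 * (M / 2 ^ (q - r)) + 2 ^ (r - h.factorization 2) *
                (1 + Real.log (2 ^ (r - h.factorization 2))))))) := Finset.sum_le_sum hS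
    _ = (Ico 1 H).card * (N * η ^ 2 * (2 * H * M + 2 ^ q * lam)) +
        ∑ h ∈ Ico 1 H, ∑ r ∈ range q, (N + 2 ^ (q - r)) *
          (lam * (P 0 * P r) +
            2 * (min (η ^ 2 * 2 ^ (q - (r - h.factorization 2)) * 2 ^ (q - r))
                  (P (r - h.factorization 2) * P r) *
              (2 * (M / 2 ^ (q - r)) + 2 ^ (r - h.factorization 2) *
                (1 + Real.log (2 ^ (r - h.factorization 2)))))) := by
        rw [Finset.sum_add_distrib, Finset.sum_const, nsmul_eq_mul]
    _ ≤ _ := by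
        refine add_le_add ?_ le_rfl
        exact mul_le_mul_of_nonneg_right hcardH hA0

end Literature.NumberTheory.LFunctions.MoebiusWalshTypeII
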